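/- Copyright: the b2b-balaban cell (near-miss cell 7), T⁴-continuum fan-out, lineage t4-ne7b-p1 (node U5c COUNT
member).  Released under the licence of the surrounding project. -/
import Summits.QuantumFields.BalabanUV.T4Continuum.Support.HistoryBankingForestVolume
import Summits.QuantumFields.BalabanUV.T4Continuum.Support.HistoryBankingVolumePlug

/-!
# M5-2b∕c ON THE PASS-V OBJECTS — M2 brick B's volume factor split along the forest: each LIVE component's factor
inside `e^{+lifeCost (costT)}` of its tagged genealogy `pedMV.genT (K, c)` up to the weighted class remainder, the
DEAD components' factors left to the resummation (owner module of row NE7b, lineage `t4-ne7b-p1` gen 44; re-open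
object (α), `SCOPE-alpha.md` v2.6, `ROW-NE7b-STATE.md` v1.23 §5 (2); M5-2 «the witness plug», assembly of parts (b)
and (c); PRE-POSITIONING ONLY)

Summits-side support leaf of the T⁴-continuum cell (rung (B)+1 on a FINITE torus only; NOT infinite volume, NOT the
mass gap, NOT the Clay statement; NOT a proof of the spine estimate NE7b — the cell's OWN estimate, NOT PRINTED, NOT
PROVED).  [folklore] bookkeeping over M5-2b (`HistoryBankingForestVolume.prod_pow_card_le_prod_exp_forest`, `treeVol`),
M5-2c (`HistoryBankingVolumePlug.exp_volume_le_genT`, `birthWT`), the pass-V junction (`HistoryGenealogyJunctionV`: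
`renew_step_pedMV`, `forest_pedMV`, `headOldest_pedMV`, `real_pedMV`) and row S1b-W's timing kit
(`HistoryRealiseWeakTimed.consistentTLE_genT_of_realisesW` ∕ `lt_reach_genT_of_pendingBefore_W`,
`HistoryTreeShapeLE.wf_of_consistentTLE_freshT_chrono`, leaf-09's `freshT_genT` ∕ `chronoC_genT`); nothing printed is
asserted, no `def`, no cite-tagged hypothesis, zero `sorry`.  B16 = [Balaban1989LargeFieldII] pp. 380–387 under audit;
locators only.

WHAT.  §1 for a live dissolved component `c ∈ histV.comp K` (input-side conditions of the pass-V junction; flow `L ≥ 4`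
with drop control, sizes `R ≥ 1`, `13 ≤ n₁`): its tagged genealogy `pedMV.genT (K, c)` is WELL FORMED for the run's
table (`wf_genT_pedMV`) and PENDING at the cutoff (`lt_reach_genT_pedMV`), its `PGen` observed (`lastStep_toPGen_pedMV_le`)
— the three hypotheses of M5-2a∕M5-2c, discharged on the pass-V objects.  §2 **`exp_treeVol_le_pedMV`**: under the
calibrated volume displays, `exp (treeVol id pedMV u K (K, c)) ≤ exp (lifeCost (dictWT Prod.fst R C.n₁) (costT Prod.fst C
K R) (pedMV.genT (K, c))) · exp (birthWT Prod.fst (2^{d+3}·u) (pedMV.genT (K, c)))`.  §3 **`prod_pow_card_le_live_mul_dead`**: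
M2 brick B's volume factor `∏_{j ≤ K} ∏_{c ∈ histM.comp j} Λ j ^ #c.2` (`Λ ≥ 1`, `u = log ∘ Λ`) is at most
`(∏_{c ∈ histV.comp K} exp (lifeCost … (costT …) (pedMV.genT (K, c))) · exp (birthWT Prod.fst (2^{d+3}·u) (pedMV.genT (K,
c)))) · ∏_{j < K} ∏_{c ∈ histV.died j} exp (treeVol id pedMV u j (j, c))` — THE LIVE PART IN THE END's BOOKED-COST
CURRENCY WITH `κ := costT`, the dead part symbolic.

WHAT IS *NOT* DONE HERE.  The END twin consuming it (`κ := costT`, slack split `C.a + (θ + θᵥ) ≤ ½γ₀A₁²`,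
`le_prod_shapeTH_of_slack_weighted`), the credit reading of the event products, the resummation of the dead part.
HONEST: bookkeeping; NE7b NOT proved; spine 0∕9.  HONEST DEPENDENCY (cell): continuum YM on T⁴ ⇐ BetaPertH ∧ nine
spine estimates (0∕9 proved); BetaPertH ⇐ (D1) ∧ (D4) ∧ CAP+tail.  This file changes none of it.
-/

open Finset
open Literature.MathematicalPhysics.QuantumFieldTheory.Balaban1983to89
open Literature.MathematicalPhysics.QuantumFieldTheory.Balaban1983to89.B13ScaleTransfer
open Literature.MathematicalPhysics.QuantumFieldTheory.Balaban1983to89.B16SProfile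
open T4PersistenceDictionary T4PrintedShapeBanking T4TaggedShapeBanking T4BankedInduction
open Summit.QuantumFields.BalabanUV.T4Continuum.HistoryAdmissible
open Summit.QuantumFields.BalabanUV.T4Continuum.HistoryRealise
open Summit.QuantumFields.BalabanUV.T4Continuum.HistoryRealisePrint
open Summit.QuantumFields.BalabanUV.T4Continuum.HistoryRealiseWeak
open Summit.QuantumFields.BalabanUV.T4Continuum.HistoryGen
open Summit.QuantumFields.BalabanUV.T4Continuum.HistoryTreeShapeLE
open Summit.QuantumFields.BalabanUV.T4Continuum.HistoryGenealogyPedigree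
open Summit.QuantumFields.BalabanUV.T4Continuum.HistoryGenealogyInstantiate
open Summit.QuantumFields.BalabanUV.T4Continuum.HistoryBankingForestVolume
open Summit.QuantumFields.BalabanUV.T4Continuum.HistoryBankingVolumePlug

namespace Summit.QuantumFields.BalabanUV.T4Continuum.HistoryBankingForestPlug

noncomputable section

-- the structural `DecidableEq` instance of the concrete tag type `Lab (ℕ × Lab d) (Lab d)` exceeds the default
-- synthesis size (`synthInstance.maxSize` 128 — a classical fallback would not match the generic lemmas' instances)
set_option synthInstance.maxSize 1024

variable {d : ℕ} {I : RunInputM d} {C : T4PrintedShapeBanking.Consts}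

/-! ## §1 A live dissolved component's tagged genealogy: well formed, pending, observed -/

/-- the `PGen` of a live dissolved component is observed by the cutoff: `lastStep ≤ K` [folklore] -/
theorem lastStep_toPGen_pedMV_le (hN : I.NewOK) (hRm : ∀ t k, I.Rm t k ≤ I.R t)
    (hRmS : ∀ t k, I.Rm t (k + 1) ≤ I.R (t + 1)) (hRm2 : ∀ t, 2 ≤ I.Rm t 1) (hD : I.NewDisjoint) (hL : 0 < I.L)
    {K : ℕ} {c : Pt d × Finset (Pt d)} (hc : c ∈ I.histV.comp K) : (I.pedMV.toPGen id (K, c)).lastStep ≤ K :=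
  (RunInputM.pendingBefore_pedMV hN hRm hRmS hRm2 hD hL hc).1

/-- **THE TAGGED GENEALOGY OF A LIVE DISSOLVED COMPONENT IS WELL FORMED** for the run's table (flow `L ≥ 4` with drop
control, sizes `R ≥ 1`, `13 ≤ n₁`): `ConsistentTLE` from the weak realisation, `FreshT` from the forest, `Chrono` from
oldest-line-first. [folklore] -/
theorem wf_genT_pedMV (hN : I.NewOK) (hRm : ∀ t k, I.Rm t k ≤ I.R t) (hRmS : ∀ t k, I.Rm t (k + 1) ≤ I.R (t + 1))
    (hRm2 : ∀ t, 2 ≤ I.Rm t 1) (hD : I.NewDisjoint) (hL : 0 < I.L) (hL4 : 4 ≤ I.L) (hdrop : ∀ m, DropCtl I.s m)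
    (hR : ∀ t, 1 ≤ I.R t) (hn₁ : 13 ≤ C.n₁) {K : ℕ} {c : Pt d × Finset (Pt d)} (hc : c ∈ I.histV.comp K) :
    (I.pedMV.genT (K, c)).WF (dictWT Prod.fst I.R C.n₁) :=
  wf_of_consistentTLE_freshT_chrono (K := K)
    (consistentTLE_genT_of_realisesW hL4 hdrop hR C hn₁ I.pedMV id RunInputM.renew_step_pedMV
      (RunInputM.realisesW_pedMV hN hRm hRmS hRm2 hD hL hc) (lastStep_toPGen_pedMV_le hN hRm hRmS hRm2 hD hL hc))
    (Pedigree.freshT_genT (RunInputM.forest_pedMV hN hRm hRmS hRm2 hD hL) (K, c))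
    (Pedigree.chronoC_genT (RunInputM.headOldest_pedMV hN hRm hRmS hRm2 hD hL) (K, c))

/-- **… AND PENDING AT THE CUTOFF**: `K < reach` (strict pendency before `K`, `lt_reach_genT_of_pendingBefore_W`).
[folklore] -/
theorem lt_reach_genT_pedMV (hN : I.NewOK) (hRm : ∀ t k, I.Rm t k ≤ I.R t) (hRmS : ∀ t k, I.Rm t (k + 1) ≤ I.R (t + 1))
    (hRm2 : ∀ t, 2 ≤ I.Rm t 1) (hD : I.NewDisjoint) (hL : 0 < I.L) (hL4 : 4 ≤ I.L) (hdrop : ∀ m, DropCtl I.s m)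
    (hR : ∀ t, 1 ≤ I.R t) (hn₁ : 13 ≤ C.n₁) {K : ℕ} {c : Pt d × Finset (Pt d)} (hc : c ∈ I.histV.comp K) :
    K < (I.pedMV.genT (K, c)).reach (dictWT Prod.fst I.R C.n₁) :=
  lt_reach_genT_of_pendingBefore_W hL4 hdrop hR C hn₁ I.pedMV id RunInputM.renew_step_pedMV
    (RunInputM.realisesW_pedMV hN hRm hRmS hRm2 hD hL hc) (RunInputM.pendingBefore_pedMV hN hRm hRmS hRm2 hD hL hc)

/-! ## §2 The live tree volume factor in the booked-cost currency -/

/-- **A LIVE COMPONENT's TREE VOLUME FACTOR IS BOOKED BY ITS TAGGED GENEALOGY** up to the weighted class remainder: under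
the calibrated volume displays (weights `u ≥ 0` with growth `L_u` over the lag `j`, `1122^d·16·21^d·L_u ≤ 2^j∕2`,
`u_t·6(561^d j L_u + 1122^d L_u) ≤ floorK`, `u·15·126^d ≤ E₂R^{q′}`, `u·24·126^d ≤ E₃R^{q′}`),
`exp (treeVol id pedMV u K (K, c)) ≤ exp (lifeCost … (costT …) (pedMV.genT (K, c))) · exp (birthWT Prod.fst (2^{d+3}·u)
(pedMV.genT (K, c)))`. [folklore] -/
theorem exp_treeVol_le_pedMV (hN : I.NewOK) (hRm : ∀ t k, I.Rm t k ≤ I.R t) (hRmS : ∀ t k, I.Rm t (k + 1) ≤ I.R (t + 1))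
    (hRm2 : ∀ t, 2 ≤ I.Rm t 1) (hD : I.NewDisjoint) (hL : 0 < I.L) (hL4 : 4 ≤ I.L) (hdrop : ∀ m, DropCtl I.s m)
    (hR : ∀ t, 1 ≤ I.R t) (hn₁ : 13 ≤ C.n₁) (hE₂ : 0 ≤ C.E₂) (hE₃ : 0 ≤ C.E₃) {K : ℕ} {c : Pt d × Finset (Pt d)}
    (hc : c ∈ I.histV.comp K) {u : ℕ → ℝ} (hu : ∀ n, 0 ≤ u n) {Lu : ℝ} (hLu0 : 0 < Lu) {j : ℕ} (hj1 : 1 ≤ j)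
    (hLu : ∀ t i, i ≤ j → u (t + i) ≤ Lu * u t) (hsmall : (1122 : ℝ) ^ d * 16 * 21 ^ d * Lu ≤ 2 ^ j / 2)
    (huΦ : ∀ t, t ≤ K → u t * (6 * (561 ^ d * j * Lu + 1122 ^ d * Lu)) ≤ floorK C K I.R t)
    (huE₂ : ∀ n, n ≤ K → u n * (15 * 126 ^ d) ≤ C.E₂ * (I.R n : ℝ) ^ C.q')
    (huE₃ : ∀ n, n ≤ K → u n * (24 * 126 ^ d) ≤ C.E₃ * (I.R n : ℝ) ^ C.q') :
    Real.exp (treeVol I.L I.s (fun v => (v : ℝ)) I.pedMV u K (K, c)) ≤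
      Real.exp (lifeCost (dictWT Prod.fst I.R C.n₁) (costT Prod.fst C K I.R) (I.pedMV.genT (K, c))) *
        Real.exp (birthWT Prod.fst (fun n => 2 ^ (d + 3) * u n) (I.pedMV.genT (K, c))) :=
  exp_volume_le_genT hL4 hdrop hR hn₁ hE₂ hE₃ I.pedMV id RunInputM.renew_step_pedMV (K, c)
    (RunInputM.realisesW_pedMV hN hRm hRmS hRm2 hD hL hc) (wf_genT_pedMV hN hRm hRmS hRm2 hD hL hL4 hdrop hR hn₁ hc)
    (lastStep_toPGen_pedMV_le hN hRm hRmS hRm2 hD hL hc) (lt_reach_genT_pedMV hN hRm hRmS hRm2 hD hL hL4 hdrop hR hn₁ hc)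
    hu hLu0 hj1 hLu hsmall huΦ huE₂ huE₃

/-! ## §3 M2 brick B's volume factor: live part booked, dead part symbolic -/

/-- **M2 BRICK B's VOLUME FACTOR ≤ (LIVE: BOOKED LIFE COSTS × WEIGHTED CLASS REMAINDERS) × (DEAD: TREE VOLUMES)** on the
pass-V objects: for per-cube level costs `Λ j ≥ 1` with `u = log ∘ Λ` obeying the calibrated volume displays,
`∏_{j ≤ K} ∏_{c ∈ histM.comp j} Λ j ^ #c.2 ≤ (∏_{c ∈ histV.comp K} exp (lifeCost (dictWT Prod.fst R C.n₁) (costT Prod.fst C K R)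
(pedMV.genT (K, c))) · exp (birthWT Prod.fst (2^{d+3}·log ∘ Λ) (pedMV.genT (K, c)))) · ∏_{j < K} ∏_{c ∈ histV.died j}
exp (treeVol id pedMV (log ∘ Λ) j (j, c))` — with `κ := costT` the live factors sit inside `pshapeTH`'s `e^{+lifeCost … κ}`
(M5-2c), their remainders in the birth-credit slack (`le_prod_shapeTH_of_slack_weighted`), the dead factors in the
resummation. [folklore] -/
theorem prod_pow_card_le_live_mul_dead (hN : I.NewOK) (hRm : ∀ t k, I.Rm t k ≤ I.R t)
    (hRmS : ∀ t k, I.Rm t (k + 1) ≤ I.R (t + 1)) (hRm2 : ∀ t, 2 ≤ I.Rm t 1) (hD : I.NewDisjoint) (hL : 0 < I.L)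
    (hL4 : 4 ≤ I.L) (hdrop : ∀ m, DropCtl I.s m) (hR : ∀ t, 1 ≤ I.R t) (hn₁ : 13 ≤ C.n₁) (hE₂ : 0 ≤ C.E₂)
    (hE₃ : 0 ≤ C.E₃) {Λ : ℕ → ℝ} (hΛ : ∀ j, 1 ≤ Λ j) {K : ℕ} {Lu : ℝ} (hLu0 : 0 < Lu) {j : ℕ} (hj1 : 1 ≤ j)
    (hLu : ∀ t i, i ≤ j → Real.log (Λ (t + i)) ≤ Lu * Real.log (Λ t))
    (hsmall : (1122 : ℝ) ^ d * 16 * 21 ^ d * Lu ≤ 2 ^ j / 2)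
    (huΦ : ∀ t, t ≤ K → Real.log (Λ t) * (6 * (561 ^ d * j * Lu + 1122 ^ d * Lu)) ≤ floorK C K I.R t)
    (huE₂ : ∀ n, n ≤ K → Real.log (Λ n) * (15 * 126 ^ d) ≤ C.E₂ * (I.R n : ℝ) ^ C.q')
    (huE₃ : ∀ n, n ≤ K → Real.log (Λ n) * (24 * 126 ^ d) ≤ C.E₃ * (I.R n : ℝ) ^ C.q') :
    ∏ j ∈ Finset.range (K + 1), ∏ c ∈ I.histM.comp j, Λ j ^ (c.2).card ≤
      (∏ c ∈ I.histV.comp K,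
          Real.exp (lifeCost (dictWT Prod.fst I.R C.n₁) (costT Prod.fst C K I.R) (I.pedMV.genT (K, c))) *
            Real.exp (birthWT Prod.fst (fun n => 2 ^ (d + 3) * Real.log (Λ n)) (I.pedMV.genT (K, c)))) *
        ∏ j ∈ Finset.range K, ∏ c ∈ I.histV.died j,
          Real.exp (treeVol I.L I.s (fun v => (v : ℝ)) I.pedMV (fun j => Real.log (Λ j)) j (j, c)) := by
  have hu : ∀ n, 0 ≤ Real.log (Λ n) := fun n => Real.log_nonneg (hΛ n)
  refine (prod_pow_card_le_prod_exp_forest hN hRm hRmS hRm2 hD hL hΛ K).trans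
    (mul_le_mul_of_nonneg_right (Finset.prod_le_prod (fun c _ => (Real.exp_pos _).le) fun c hc =>
      exp_treeVol_le_pedMV hN hRm hRmS hRm2 hD hL hL4 hdrop hR hn₁ hE₂ hE₃ hc hu hLu0 hj1 hLu hsmall huΦ huE₂ huE₃)
      (Finset.prod_nonneg fun j _ => Finset.prod_nonneg fun c _ => (Real.exp_pos _).le))

end

end Summit.QuantumFields.BalabanUV.T4Continuum.HistoryBankingForestPlug
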